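import Summits.QuantumFields.YangMills.Theorems.ColdStartUniversalityLatticeLangevinPointwiseMixingExplicit
import Summits.QuantumFields.YangMills.Theorems.ColdStartUniversalityUniformColdStartMixingFixedCutoffMixingTimeWindow
import Summits.QuantumFields.YangMills.Theorems.ColdStartUniversalityUniformColdStartMixingRungOfErgodic
import HarnessLib

/-!
# Route `ColdStartUniversality`, aside K_A1 `UniformColdStartMixing` (24809) — the rung `stub_fixedCutoffMixing` WITH AN EXPLICIT TIME:
# at every cut-off `K`, `|expectAt K os − T⁻¹∫₀ᵀ E[Π avgObs(U(s/ε_K))] ds| ≤ δ` for EVERY physical time `T ≥ ε_K·(T_c + 4T_c/δ)`, every start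

Helper file (seat `ym-line-csu-p1`, g27; `--supports stmt-QuantumFields-24809`).  g8 closed the plan-only rung `stub_fixedCutoffMixing` (∃ T > 0 …) by
Doeblin constants that are only known to exist.  The explicit Cesàro theorems of `…PointwiseMixingExplicit` + the Gibbs dictionary
`expectAt_eq_integral_wilsonMeasure` + the bond-dictionary observables (`measurable_prodAvgObs_pullback`, `abs_prodAvgObs_pullback_le_one`) +
the time change `inv_mul_integral_comp_div` give the rung's conclusion for ALL large `T` with `T` EXPLICIT, and for every deterministic start
(not only the cold one):
* ★★ `fixedCutoffMixing_explicit_window` — at cut-offs with `6 < γ ε_K` (`β'_K < 1/12`): every physical time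
  `T ≥ ε_K·(T_c + 4T_c/δ)`, `T_c = 2 + log(2√(2B_K)/δ)/(1 − 6/(γε_K))`, `B_K = 366β'_K L_K³ + 3log(3/2)L_K³ + log 2` — so
  `T_K(δ) = O(ε_K·(log L_K + log(1/δ))/δ)`;
* ★★ `fixedCutoffMixing_explicit_allCutoffs` — at EVERY cut-off, the same with `1 − 6/(γε_K)` replaced by the Holley–Stroock rate
  `2ρ_K = e^(−4β'_K·#𝒫_K)`: `T_K(δ) = O(ε_K·e^(2L_K³/(γε_K))·(log L_K + log(1/δ))/δ)` — the honest, super-exponentially large witness of how the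
  fixed-cut-off rung fails to be uniform in `K` outside the strong-coupling window (planner: BC5 «witness of weakness»).
PLANNER-FACING, HONEST: 24809 is ASIDE and NOT restated (the rung statement is re-derived here only in its ∀-large-`T` explicit form); nothing
K-uniform is proved; no crux, rung of the ladder or summit statement is proved; the Yang–Mills mass gap is NOT proved.  THEOREMS ONLY, no sorry.
-/

set_option autoImplicit false

noncomputable section

namespace Summit.QuantumFields.YangMills.Theorems.ColdStartUniversality

open MeasureTheory ProbabilityTheory intervalIntegral
open scoped NNReal ENNReal BigOperators
open Literature.Probability.Process Literature.MathematicalPhysics.QuantumFieldTheory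
open Literature.MathematicalPhysics.QuantumLattice (fundamentalRep fundamentalLatticeRep continuous_fundamentalRep)
open Literature.MathematicalPhysics.QuantumFieldTheory.Balaban1983to89

/-- ★★ **The rung with an explicit time, strong-coupling window.**  For `F, γ, os, δ > 0` and a cut-off `K` with `6 < γ ε_K`: for EVERY physical
time `T ≥ ε_K·(T_c + 4T_c/δ)` (`T_c = 2 + log(2√(2B_K)/δ)/(1 − 6/(γε_K))`), every deterministic start `z` and every solution of the SZZ dynamics at
`β'_K = (γε_K)⁻¹/2` from `z`: `|expectAt K os − T⁻¹ ∫₀ᵀ E[Π_(C∈os) avgObs K C (U(s/ε_K))] ds| ≤ δ`. [cite: ShenZhuZhu2022, §4 Theorem 4.2, Corollary 4.4] -/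
theorem fixedCutoffMixing_explicit_window (F : T3ContinuumYM3Torus.T3Family) (γ : ℝ) (os : List (T3ContinuumYM3Torus.ULoop3 F))
    {δ : ℝ} (hδ : 0 < δ) (K : ℕ) (hK : 6 < γ * (F.P K).eps) (z : (GaugeConfig 3 ((F.P K).sitesPerDir 0) (Matrix.specialUnitaryGroup (Fin 2) ℂ)))
    {Ω : Type} [MeasurableSpace Ω] {P : Measure Ω} [IsProbabilityMeasure P]
    {W : ℝ≥0 → Ω → (Edge 3 ((F.P K).sitesPerDir 0) × NoiseIdx 2 → ℝ)} (hW : IsFlatBrownian W P)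
    {U : ℝ≥0 → Ω → (GaugeConfig 3 ((F.P K).sitesPerDir 0) (Matrix.specialUnitaryGroup (Fin 2) ℂ))} (hU0 : ∀ ω, U 0 ω = z)
    (hU : (latticeLangevinDynamics (fundamentalLatticeRep 2) ((γ * (F.P K).eps)⁻¹ / 2)).IsSolution (fundamentalRep (Fin 2)) hW.natFiltration P W U)
    {T : ℝ} (hT : (F.P K).eps * ((2 + Real.log (2 * Real.sqrt (2 * (366 * |((γ * (F.P K).eps)⁻¹ / 2)| * (((F.P K).sitesPerDir 0) : ℝ) ^ 3 + 3 * Real.log (3 / 2) * (((F.P K).sitesPerDir 0) : ℝ) ^ 3 + Real.log 2)) / δ) / (1 - 6 / (γ * (F.P K).eps))) + 4 * (2 + Real.log (2 * Real.sqrt (2 * (366 * |((γ * (F.P K).eps)⁻¹ / 2)| * (((F.P K).sitesPerDir 0) : ℝ) ^ 3 + 3 * Real.log (3 / 2) * (((F.P K).sitesPerDir 0) : ℝ) ^ 3 + Real.log 2)) / δ) / (1 - 6 / (γ * (F.P K).eps))) / δ) ≤ T) :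
    |(F.scheme (ExpMeanLog.expMeanLogSU : LoopAverage (Matrix.specialUnitaryGroup (Fin 2) ℂ)) γ).expectAt K os -
        T⁻¹ * ∫ s in (0 : ℝ)..T, (∫ ω, (os.map fun C => F.avgObs (ExpMeanLog.expMeanLogSU : LoopAverage (Matrix.specialUnitaryGroup (Fin 2) ℂ)) K C (fun b : PBond (F.P K) 0 => U (s / (F.P K).eps).toNNReal ω (b.src, b.dir))).prod ∂P)| ≤ δ := by
  obtain ⟨hβ, hrate⟩ := window_coupling_bounds F γ K hK
  have hε : 0 < (F.P K).eps := (F.P K).eps_pos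
  have hfm := measurable_prodAvgObs_pullback F K os
  have hfb := abs_prodAvgObs_pullback_le_one F K os
  -- lattice time `T / ε_K`
  set Tl : ℝ := T / (F.P K).eps with hTl
  have hTl' : (2 + Real.log (2 * Real.sqrt (2 * (366 * |((γ * (F.P K).eps)⁻¹ / 2)| * (((F.P K).sitesPerDir 0) : ℝ) ^ 3 + 3 * Real.log (3 / 2) * (((F.P K).sitesPerDir 0) : ℝ) ^ 3 + Real.log 2)) / δ) / (1 - 6 / (γ * (F.P K).eps))) + 4 * (2 + Real.log (2 * Real.sqrt (2 * (366 * |((γ * (F.P K).eps)⁻¹ / 2)| * (((F.P K).sitesPerDir 0) : ℝ) ^ 3 + 3 * Real.log (3 / 2) * (((F.P K).sitesPerDir 0) : ℝ) ^ 3 + Real.log 2)) / δ) / (1 - 6 / (γ * (F.P K).eps))) / δ ≤ Tl := by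
    rw [hTl, le_div_iff₀ hε, mul_comm]; exact hT
  have hTl'' : (2 + Real.log (2 * Real.sqrt (2 * (366 * |((γ * (F.P K).eps)⁻¹ / 2)| * (((F.P K).sitesPerDir 0) : ℝ) ^ 3 + 3 * Real.log (3 / 2) * (((F.P K).sitesPerDir 0) : ℝ) ^ 3 + Real.log 2)) / δ) / (1 - 12 * |((γ * (F.P K).eps)⁻¹ / 2)|)) +
      4 * (2 + Real.log (2 * Real.sqrt (2 * (366 * |((γ * (F.P K).eps)⁻¹ / 2)| * (((F.P K).sitesPerDir 0) : ℝ) ^ 3 + 3 * Real.log (3 / 2) * (((F.P K).sitesPerDir 0) : ℝ) ^ 3 + Real.log 2)) / δ) / (1 - 12 * |((γ * (F.P K).eps)⁻¹ / 2)|)) / δ ≤ Tl := by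
    rw [hrate]; exact hTl'
  have key := wilson_coldStart_cesaro_explicit ((F.P K).sitesPerDir 0) ((γ * (F.P K).eps)⁻¹ / 2) hβ z hW hU0 hU hfm hfb hδ hTl''
  rw [expectAt_eq_integral_wilsonMeasure F γ K os]
  have hTeq : T = (F.P K).eps * Tl := by rw [hTl]; field_simp
  by_cases hT0 : Tl = 0
  · -- then `T = 0` and the Cesàro mean is `0`; the lattice statement at `Tl = 0` is the same number
    rw [hTeq, hT0, mul_zero]
    rw [hT0] at key
    simpa using key
  · have hchange := inv_mul_integral_comp_div
      (fun t : ℝ => ∫ ω, (os.map fun C => F.avgObs (ExpMeanLog.expMeanLogSU : LoopAverage (Matrix.specialUnitaryGroup (Fin 2) ℂ)) K C (fun b : PBond (F.P K) 0 => U t.toNNReal ω (b.src, b.dir))).prod ∂P) hε.ne' hT0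
    rw [hTeq, hchange]
    exact key

/-- ★★ **The rung with an explicit time at EVERY cut-off** (Holley–Stroock rate `2ρ_K = e^(−4β'_K #𝒫_K)`): for every physical time
`T ≥ ε_K·(T_c + 4T_c/δ)`, `T_c = 2 + log(2√(2B_K)/δ)/(2ρ_K)`, every start and every solution:
`|expectAt K os − T⁻¹ ∫₀ᵀ E[Π avgObs (U(s/ε_K))] ds| ≤ δ`.  The witness `T_K(δ)` is super-exponential in the volume `L_K³` — the honest size of
the fixed-cut-off rung outside the window. [cite: BakryGentilLedoux2014, Thm 5.2.1] -/
theorem fixedCutoffMixing_explicit_allCutoffs (F : T3ContinuumYM3Torus.T3Family) (γ : ℝ) (os : List (T3ContinuumYM3Torus.ULoop3 F))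
    {δ : ℝ} (hδ : 0 < δ) (K : ℕ) (z : (GaugeConfig 3 ((F.P K).sitesPerDir 0) (Matrix.specialUnitaryGroup (Fin 2) ℂ)))
    {Ω : Type} [MeasurableSpace Ω] {P : Measure Ω} [IsProbabilityMeasure P]
    {W : ℝ≥0 → Ω → (Edge 3 ((F.P K).sitesPerDir 0) × NoiseIdx 2 → ℝ)} (hW : IsFlatBrownian W P)
    {U : ℝ≥0 → Ω → (GaugeConfig 3 ((F.P K).sitesPerDir 0) (Matrix.specialUnitaryGroup (Fin 2) ℂ))} (hU0 : ∀ ω, U 0 ω = z)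
    (hU : (latticeLangevinDynamics (fundamentalLatticeRep 2) ((γ * (F.P K).eps)⁻¹ / 2)).IsSolution (fundamentalRep (Fin 2)) hW.natFiltration P W U)
    {T : ℝ} (hT : (F.P K).eps * ((2 + Real.log (2 * Real.sqrt (2 * (366 * |((γ * (F.P K).eps)⁻¹ / 2)| * (((F.P K).sitesPerDir 0) : ℝ) ^ 3 + 3 * Real.log (3 / 2) * (((F.P K).sitesPerDir 0) : ℝ) ^ 3 + Real.log 2)) / δ) / (2 * ((1 / 2 : ℝ) * Real.exp (-(|((γ * (F.P K).eps)⁻¹ / 2)| * (4 * (Fintype.card (Plaquette 3 ((F.P K).sitesPerDir 0)) : ℝ))))))) + 4 * (2 + Real.log (2 * Real.sqrt (2 * (366 * |((γ * (F.P K).eps)⁻¹ / 2)| * (((F.P K).sitesPerDir 0) : ℝ) ^ 3 + 3 * Real.log (3 / 2) * (((F.P K).sitesPerDir 0) : ℝ) ^ 3 + Real.log 2)) / δ) / (2 * ((1 / 2 : ℝ) * Real.exp (-(|((γ * (F.P K).eps)⁻¹ / 2)| * (4 * (Fintype.card (Plaquette 3 ((F.P K).sitesPerDir 0)) : ℝ)))))))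 / δ) ≤ T) :
    |(F.scheme (ExpMeanLog.expMeanLogSU : LoopAverage (Matrix.specialUnitaryGroup (Fin 2) ℂ)) γ).expectAt K os -
        T⁻¹ * ∫ s in (0 : ℝ)..T, (∫ ω, (os.map fun C => F.avgObs (ExpMeanLog.expMeanLogSU : LoopAverage (Matrix.specialUnitaryGroup (Fin 2) ℂ)) K C (fun b : PBond (F.P K) 0 => U (s / (F.P K).eps).toNNReal ω (b.src, b.dir))).prod ∂P)| ≤ δ := by
  have hε : 0 < (F.P K).eps := (F.P K).eps_pos
  have hfm := measurable_prodAvgObs_pullback F K os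
  have hfb := abs_prodAvgObs_pullback_le_one F K os
  set Tl : ℝ := T / (F.P K).eps with hTl
  have hTl' : (2 + Real.log (2 * Real.sqrt (2 * (366 * |((γ * (F.P K).eps)⁻¹ / 2)| * (((F.P K).sitesPerDir 0) : ℝ) ^ 3 + 3 * Real.log (3 / 2) * (((F.P K).sitesPerDir 0) : ℝ) ^ 3 + Real.log 2)) / δ) / (2 * ((1 / 2 : ℝ) * Real.exp (-(|((γ * (F.P K).eps)⁻¹ / 2)| * (4 * (Fintype.card (Plaquette 3 ((F.P K).sitesPerDir 0)) : ℝ))))))) + 4 * (2 + Real.log (2 * Real.sqrt (2 * (366 * |((γ * (F.P K).eps)⁻¹ / 2)| * (((F.P K).sitesPerDir 0) : ℝ) ^ 3 + 3 * Real.log (3 / 2) * (((F.P K).sitesPerDir 0) : ℝ) ^ 3 + Real.log 2)) / δ) / (2 * ((1 / 2 : ℝ) * Real.exp (-(|((γ * (F.P K).eps)⁻¹ / 2)| * (4 * (Fintype.card (Plaquette 3 ((F.P K).sitesPerDir 0)) : ℝ))))))) / δ ≤ Tl := by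
    rw [hTl, le_div_iff₀ hε, mul_comm]; exact hT
  have key := wilson_coldStart_cesaro_allCoupling_explicit ((F.P K).sitesPerDir 0) ((γ * (F.P K).eps)⁻¹ / 2) z hW hU0 hU hfm hfb hδ hTl'
  rw [expectAt_eq_integral_wilsonMeasure F γ K os]
  have hTeq : T = (F.P K).eps * Tl := by rw [hTl]; field_simp
  by_cases hT0 : Tl = 0
  · rw [hTeq, hT0, mul_zero]
    rw [hT0] at key
    simpa using key
  · have hchange := inv_mul_integral_comp_div
      (fun t : ℝ => ∫ ω, (os.map fun C => F.avgObs (ExpMeanLog.expMeanLogSU : LoopAverage (Matrix.specialUnitaryGroup (Fin 2) ℂ)) K C (fun b : PBond (F.P K) 0 => U t.toNNReal ω (b.src, b.dir))).prod ∂P) hε.ne' hT0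
    rw [hTeq, hchange]
    exact key

end Summit.QuantumFields.YangMills.Theorems.ColdStartUniversality
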